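import Summits.AnomalousDissipation.AnomalousDissipation.Theses.MirrorVariety
import Mathlib.Analysis.Calculus.BumpFunction.InnerProduct
import Mathlib.Analysis.Calculus.BumpFunction.Basic
import Mathlib.Analysis.InnerProductSpace.PiL2
import Mathlib.Analysis.Calculus.ContDiff.Operations
import HarnessLib

/-!
# Stub `stub_coerciveCutoff` (D2) of the line `Sketch` (half-turn parity forcing)
# (crux stmt-AnomalousDissipation-15060, `MirrorVariety.TaylorGreenLogLoudStates`)

**Coercive cut-off to the identity.** A `C¹` field `F` on the Euclidean space `ℝⁿ` which is
COERCIVE on and beyond the sphere of radius `R > 0` (`⟪F c, c⟫ > 0` for `‖c‖ ≥ R`) agrees on the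
closed ball `‖c‖ ≤ R` with a `C¹` field `G` which IS THE IDENTITY for `‖c‖ ≥ R + 1` and is still
coercive for `‖c‖ ≥ R` (in particular no zeros are gained: all zeros of `G` lie in the open ball
`‖c‖ < R`, where `G = F`).

Why: the line's lever (a ℤ₂-twisted Brouwer-degree count) was reduced by the lead to the signed
zero count `∑ sign det DG = 1` for `C¹` fields EQUAL TO THE IDENTITY outside a ball
(`stub_signedCountIdOutside`, D1b); the present statement (D2) transports that count to coercive
fields (`coerciveSignedCount_of` in the skeleton), since `F` and `G` have the same zeros and the
same Jacobians there.

Construction (Krasnosel'skiĭ–Zabreĭko, *Geometrical Methods of Nonlinear Analysis* (1984), Ch. 1,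
§2: the Poincaré–Bohl flavour "two fields never pointing against each other", but NO homotopy /
degree argument is needed here — only a pointwise convex combination): with Mathlib's smooth bump
`b : ContDiffBump 0`, `rIn = R`, `rOut = R + 1` (`b = 1` on `closedBall 0 R`, `b = 0` off
`ball 0 (R + 1)`, `0 ≤ b ≤ 1`, `b` smooth since inner product spaces carry `HasContDiffBump`), put

  `G c = b c • F c + (1 - b c) • c`.

Then `G` is `C¹` (`ContDiff.smul`, `ContDiff.add`), `G = F` where `b = 1`, `G = id` where `b = 0`,
and for `‖c‖ ≥ R`: `⟪G c, c⟫ = b c · ⟪F c, c⟫ + (1 - b c) · ‖c‖²` is a sum of two nonnegative terms,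
the first positive when `b c > 0` and the second equal to `‖c‖² ≥ R² > 0` when `b c = 0`
(`inner_convexComb_id_pos`). Mathlib only; no definitions, no named facts, no `sorry`.

## References

* M. A. Krasnosel'skiĭ, P. P. Zabreĭko, *Geometrical Methods of Nonlinear Analysis* (1984), Ch. 1,
  §2 (Thm 2.1, Poincaré–Bohl). [KrasnoselskiiZabreiko1984]
-/

-- `Summit.<Summit>.<Problem>` is the tree's mandated summit-side namespace (CONVENTIONS §2); duplicate deliberate.
set_option linter.dupNamespace false

noncomputable section

open Metric
open scoped InnerProductSpace

namespace Summit.AnomalousDissipation.AnomalousDissipation.Theorems.TaylorGreenLogLoudStates.HalfTurn.Cutoff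

/-! ## The pointwise convex combination with the identity stays coercive -/

/-- **Convex combinations with the identity preserve coercivity, pointwise.** In a real inner
product space, if `0 < R ≤ ‖c‖`, `0 ≤ t ≤ 1` and `⟪v, c⟫ > 0`, then
`⟪t • v + (1 - t) • c, c⟫ = t · ⟪v, c⟫ + (1 - t) · ‖c‖² > 0`: both terms are nonnegative, the first
is positive when `t > 0`, the second equals `‖c‖² ≥ R² > 0` when `t = 0`. [folklore] -/
theorem inner_convexComb_id_pos {E : Type*} [NormedAddCommGroup E] [InnerProductSpace ℝ E]
    {R t : ℝ} (hR : 0 < R) (ht0 : 0 ≤ t) (ht1 : t ≤ 1) {v c : E} (hc : R ≤ ‖c‖)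
    (hv : 0 < ⟪v, c⟫_ℝ) : 0 < ⟪t • v + (1 - t) • c, c⟫_ℝ := by
  rw [inner_add_left, real_inner_smul_left, real_inner_smul_left, real_inner_self_eq_norm_sq]
  have hc2 : 0 < ‖c‖ ^ 2 := pow_pos (hR.trans_le hc) 2
  rcases ht0.eq_or_lt with h | h
  · subst h
    simpa using hc2
  · have h1 : 0 < t * ⟪v, c⟫_ℝ := mul_pos h hv
    have h2 : 0 ≤ (1 - t) * ‖c‖ ^ 2 := mul_nonneg (sub_nonneg.2 ht1) hc2.le
    linarith

/-! ## The registered stub -/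

/-- **Stub `stub_coerciveCutoff`** (D2, = `CoerciveCutoff` of the skeleton) — coercive cut-off to
the identity: a `C¹` field `F` on `ℝⁿ` with `⟪F c, c⟫ > 0` for `‖c‖ ≥ R > 0` agrees on the closed
ball `‖c‖ ≤ R` with a `C¹` field `G` which is the identity for `‖c‖ ≥ R + 1` and still satisfies
`⟪G c, c⟫ > 0` for `‖c‖ ≥ R`. Proof: `G c = b c • F c + (1 - b c) • c` for Mathlib's smooth bump
`b : ContDiffBump 0` with `rIn = R`, `rOut = R + 1` (`ContDiffBump.one_of_mem_closedBall`,
`ContDiffBump.zero_of_le_dist`, `ContDiffBump.nonneg`, `ContDiffBump.le_one`,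
`ContDiffBump.contDiff`), and `inner_convexComb_id_pos` pointwise. (Krasnosel'skiĭ–Zabreĭko 1984,
Ch. 1 §2 flavour; no homotopy needed.) [folklore] -/
theorem stub_coerciveCutoff :
    ∀ (n : ℕ) (F : EuclideanSpace ℝ (Fin n) → EuclideanSpace ℝ (Fin n)) (R : ℝ), 0 < R → ContDiff ℝ 1 F →
    (∀ c, R ≤ ‖c‖ → 0 < ⟪F c, c⟫_ℝ) →
    ∃ G : EuclideanSpace ℝ (Fin n) → EuclideanSpace ℝ (Fin n), ContDiff ℝ 1 G ∧
      (∀ c, ‖c‖ ≤ R → G c = F c) ∧ (∀ c, R + 1 ≤ ‖c‖ → G c = c) ∧ (∀ c, R ≤ ‖c‖ → 0 < ⟪G c, c⟫_ℝ) := by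
  intro n F R hR hF hco
  -- the smooth bump `b`: `b = 1` on `closedBall 0 R`, `b = 0` off `ball 0 (R + 1)`, `0 ≤ b ≤ 1`
  obtain ⟨b, hbIn, hbOut⟩ : ∃ b : ContDiffBump (0 : EuclideanSpace ℝ (Fin n)),
      b.rIn = R ∧ b.rOut = R + 1 := ⟨⟨R, R + 1, hR, lt_add_one R⟩, rfl, rfl⟩
  have hb : ContDiff ℝ 1 (b : EuclideanSpace ℝ (Fin n) → ℝ) := b.contDiff
  refine ⟨fun c => b c • F c + (1 - b c) • c, ?_, ?_, ?_, ?_⟩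
  · -- `C¹`: products and sums of `C¹` maps
    exact (hb.smul hF).add ((contDiff_const.sub hb).smul contDiff_id)
  · -- `G = F` on the closed ball, where `b = 1`
    intro c hc
    have h1 : b c = 1 := b.one_of_mem_closedBall (by rw [mem_closedBall, dist_zero_right, hbIn]; exact hc)
    simp [h1]
  · -- `G = id` for `R + 1 ≤ ‖c‖`, where `b = 0`
    intro c hc
    have h0 : b c = 0 := b.zero_of_le_dist (by rw [dist_zero_right, hbOut]; exact hc)
    simp [h0]
  · -- coercivity for `R ≤ ‖c‖`: a convex combination of two vectors pairing positively with `c`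
    intro c hc
    exact inner_convexComb_id_pos hR b.nonneg b.le_one hc (hco c hc)

end Summit.AnomalousDissipation.AnomalousDissipation.Theorems.TaylorGreenLogLoudStates.HalfTurn.Cutoff

end
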